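import Mathlib
import Literature.NumberTheory.LFunctions.SuzukiCanonicalSystem
import Literature.NumberTheory.LFunctions.SuzukiSingleOperatorKernelProofs
import Summits.RiemannHypothesis.RiemannHypothesis.Theorems.SuzukiWindowsDoorTempleWindow
import HarnessLib

/-!
# From one-sided quadratic-form bounds to clean windows (RH-free, K-general) — the Temple-route data rung

Closing piece of the Temple line (`SuzukiWindowsDoorTemple`, `…TempleMirror`, `…TempleGalerkin`, `…TempleWindow`):
(1) `noUnitEigenvalue_of_quadForm_bounds_of_le` — if on the window `S = (−t,t)` the quadratic form of `𝖪[t]`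
satisfies `∫_S f 𝖪f ≤ βp ∫_S f²` and `−βm ∫_S f² ≤ ∫_S f 𝖪f` for all `f ∈ L²(S)` with `βp < 1`, `βm < 1`, then
`NoUnitEigenvalue K t′` for EVERY `t′ ≤ t` (zero-extension of an eigenfunction, as in p439269);
(2) `noUnitEigenvalue_of_temple_certificates_of_le` — two Temple–Galerkin certificates, one for `K` (top Ritz data)
and one for `−K` (bottom Ritz data; `𝖪_{−K} = −𝖪_K`), give exactly these bounds; (3) the `limKernel θ` instance.
This is the kernel-checked logic of an rh-dbr ET1e leg certified by the Temple route on both ends.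
RH-FREE; a clean window is an RH-consequence check, never evidence for RH; nothing here bears on the truth of RH.
-/

set_option linter.dupNamespace false

noncomputable section

open MeasureTheory Set

namespace Summit.RiemannHypothesis.RiemannHypothesis.Theorems.SuzukiWindowsDoorTempleGalerkin

/-- **Clean windows from one-sided form bounds** (RH-free, K-general): `∫_S f 𝖪f ≤ βp‖f‖²` and
`−βm‖f‖² ≤ ∫_S f 𝖪f` on `L²(S)`, `S = (−t,t)`, with `βp, βm < 1` exclude the eigenvalues `±1` of `𝖪[t′]` for every
`t′ ≤ t`. [cite: Suzuki2021Hamiltonians, §3.4; folklore] -/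
theorem noUnitEigenvalue_of_quadForm_bounds_of_le {K : ℝ → ℝ} {t βp βm : ℝ} (hβp : βp < 1) (hβm : βm < 1)
    (hup : ∀ f : ℝ → ℝ, MemLp f 2 (volume.restrict (Ioo (-t) t)) →
      ∫ x in Ioo (-t) t, f x * ∫ y in Ioo (-t) t, K (x + y) * f y ≤ βp * ∫ x in Ioo (-t) t, f x ^ 2)
    (hlo : ∀ f : ℝ → ℝ, MemLp f 2 (volume.restrict (Ioo (-t) t)) →
      -(βm * ∫ x in Ioo (-t) t, f x ^ 2) ≤ ∫ x in Ioo (-t) t, f x * ∫ y in Ioo (-t) t, K (x + y) * f y)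
    {t' : ℝ} (ht' : t' ≤ t) :
    Literature.NumberTheory.LFunctions.NoUnitEigenvalue K t' := by
  intro ε hε f hf heig
  have hSS : Ioo (-t') t' ⊆ Ioo (-t) t := Ioo_subset_Ioo (neg_le_neg ht') ht'
  have hres : (volume.restrict (Ioo (-t) t)).restrict (Ioo (-t') t') = volume.restrict (Ioo (-t') t') := by
    rw [Measure.restrict_restrict measurableSet_Ioo, Set.inter_eq_left.2 hSS]
  -- the zero-extension g of f is in L²(−t,t)
  have hgL2 : MemLp ((Ioo (-t') t').indicator f) 2 (volume.restrict (Ioo (-t) t)) := by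
    rw [memLp_indicator_iff_restrict measurableSet_Ioo, hres]
    exact hf
  have hQup := hup _ hgL2
  have hQlo := hlo _ hgL2
  -- ∫ g² = ∫_{S'} f²
  have hA : ∫ x in Ioo (-t) t, (Ioo (-t') t').indicator f x ^ 2 = ∫ x in Ioo (-t') t', f x ^ 2 := by
    have h1 : (fun x => (Ioo (-t') t').indicator f x ^ 2) = (Ioo (-t') t').indicator (fun x => f x ^ 2) := by
      funext x
      by_cases hx : x ∈ Ioo (-t') t'
      · simp [Set.indicator_of_mem hx]
      · simp [Set.indicator_of_notMem hx]
    rw [h1, integral_indicator measurableSet_Ioo, hres]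
  -- the quadratic form of g equals ε ∫_{S'} f²
  have hinner : ∀ x, ∫ y in Ioo (-t) t, K (x + y) * (Ioo (-t') t').indicator f y =
      ∫ y in Ioo (-t') t', K (x + y) * f y := by
    intro x
    have h1 : (fun y => K (x + y) * (Ioo (-t') t').indicator f y) =
        (Ioo (-t') t').indicator (fun y => K (x + y) * f y) := by
      funext y; rw [Set.indicator_mul_right]
    rw [h1, integral_indicator measurableSet_Ioo, hres]
  have hQeq : ∫ x in Ioo (-t) t, (Ioo (-t') t').indicator f x *
        ∫ y in Ioo (-t) t, K (x + y) * (Ioo (-t') t').indicator f y =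
      ε * ∫ x in Ioo (-t') t', f x ^ 2 := by
    have h1 : (fun x => (Ioo (-t') t').indicator f x *
        ∫ y in Ioo (-t) t, K (x + y) * (Ioo (-t') t').indicator f y) =
        (Ioo (-t') t').indicator (fun x => f x * ∫ y in Ioo (-t') t', K (x + y) * f y) := by
      funext x; rw [hinner x, Set.indicator_mul_left]
    rw [h1, integral_indicator measurableSet_Ioo, hres]
    have h2 : (fun x => f x * ∫ y in Ioo (-t') t', K (x + y) * f y) =ᵐ[volume.restrict (Ioo (-t') t')]
        fun x => ε * f x ^ 2 := by
      filter_upwards [heig] with x hx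
      rw [hx]; ring
    rw [integral_congr_ae h2, integral_const_mul]
  -- conclude A' = 0
  set A' : ℝ := ∫ x in Ioo (-t') t', f x ^ 2 with hA'
  have hA'0 : 0 ≤ A' := integral_nonneg fun x => sq_nonneg _
  rw [hQeq, hA] at hQup hQlo
  have hA'z : A' = 0 := by
    rcases hε with rfl | rfl
    · nlinarith [hQup, hβp, hA'0]
    · nlinarith [hQlo, hβm, hA'0]
  have hf2 : Integrable (fun x => f x ^ 2) (volume.restrict (Ioo (-t') t')) := hf.integrable_sq
  have hsq : (fun x => f x ^ 2) =ᵐ[volume.restrict (Ioo (-t') t')] 0 := by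
    have := (integral_eq_zero_iff_of_nonneg_ae (Filter.Eventually.of_forall fun x => sq_nonneg (f x)) hf2).1
    exact this hA'z
  filter_upwards [hsq] with x hx
  simpa using hx

/-- **Two Temple–Galerkin certificates ⇒ clean windows** (RH-free, K-general): a Temple certificate for `K`
(orthonormal bounded measurable `φ`, matrix `M` with form `≤ a₀` on `u^⊥`, remainder `δ`, top Ritz integrals
`η₁ ≤ ∫u_S𝖪u_S ≤ η₂`, `∫(𝖪u_S)² ≤ ρ₂`, giving `βp = η₂ + (ρ₂ − η₁²)/(η₁ − a₀ − δ)`) and one for `−K` (data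
`φ', M', v, a₀', δ', η₁', η₂', ρ₂'`, giving `βm`) with `βp < 1`, `βm < 1` yield `NoUnitEigenvalue K t′` for all
`t′ ≤ t`.  [folklore: Temple 1928; cite: Suzuki2021Hamiltonians, §3.4] -/
theorem noUnitEigenvalue_of_temple_certificates_of_le {K : ℝ → ℝ} (hK : Continuous K) {t : ℝ}
    -- top certificate (for K)
    {n : ℕ} {φ : Fin n → ℝ → ℝ} (hφm : ∀ i, Measurable (φ i)) {B : ℝ} (hφb : ∀ i x, |φ i x| ≤ B)
    (horth : ∀ i j, ∫ x in Ioo (-t) t, φ i x * φ j x = if i = j then 1 else 0)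
    (M : Matrix (Fin n) (Fin n) ℝ) (u : Fin n → ℝ) (hu : ∑ i, u i ^ 2 = 1)
    {a₀ δ η₁ η₂ ρ₂ : ℝ} (ha₀ : 0 ≤ a₀) (hδ : 0 < δ)
    (hM : ∀ c : Fin n → ℝ, ∑ i, u i * c i = 0 → ∑ i, ∑ j, c i * M i j * c j ≤ a₀ * ∑ i, c i ^ 2)
    (hD : ∫ x in Ioo (-t) t, ∫ y in Ioo (-t) t,
      (K (x + y) - ∑ i, ∑ j, M i j * φ i x * φ j y) ^ 2 ≤ δ ^ 2)
    (hη₁ : η₁ ≤ ∫ x in Ioo (-t) t, (∑ i, u i * φ i x) * ∫ y in Ioo (-t) t, K (x + y) * ∑ i, u i * φ i y)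
    (hη₂ : ∫ x in Ioo (-t) t, (∑ i, u i * φ i x) * ∫ y in Ioo (-t) t, K (x + y) * ∑ i, u i * φ i y ≤ η₂)
    (hρ₂ : ∫ x in Ioo (-t) t, (∫ y in Ioo (-t) t, K (x + y) * ∑ i, u i * φ i y) ^ 2 ≤ ρ₂)
    (ha : a₀ + δ < η₁) (hpos : 0 < η₁)
    (hβp : η₂ + (ρ₂ - η₁ ^ 2) / (η₁ - (a₀ + δ)) < 1)
    -- bottom certificate (for −K)
    {n' : ℕ} {φ' : Fin n' → ℝ → ℝ} (hφm' : ∀ i, Measurable (φ' i)) {B' : ℝ} (hφb' : ∀ i x, |φ' i x| ≤ B')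
    (horth' : ∀ i j, ∫ x in Ioo (-t) t, φ' i x * φ' j x = if i = j then 1 else 0)
    (M' : Matrix (Fin n') (Fin n') ℝ) (v : Fin n' → ℝ) (hv : ∑ i, v i ^ 2 = 1)
    {a₀' δ' η₁' η₂' ρ₂' : ℝ} (ha₀' : 0 ≤ a₀') (hδ' : 0 < δ')
    (hM' : ∀ c : Fin n' → ℝ, ∑ i, v i * c i = 0 → ∑ i, ∑ j, c i * M' i j * c j ≤ a₀' * ∑ i, c i ^ 2)
    (hD' : ∫ x in Ioo (-t) t, ∫ y in Ioo (-t) t,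
      (-K (x + y) - ∑ i, ∑ j, M' i j * φ' i x * φ' j y) ^ 2 ≤ δ' ^ 2)
    (hη₁' : η₁' ≤ ∫ x in Ioo (-t) t, (∑ i, v i * φ' i x) * ∫ y in Ioo (-t) t, -K (x + y) * ∑ i, v i * φ' i y)
    (hη₂' : ∫ x in Ioo (-t) t, (∑ i, v i * φ' i x) * ∫ y in Ioo (-t) t, -K (x + y) * ∑ i, v i * φ' i y ≤ η₂')
    (hρ₂' : ∫ x in Ioo (-t) t, (∫ y in Ioo (-t) t, -K (x + y) * ∑ i, v i * φ' i y) ^ 2 ≤ ρ₂')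
    (ha' : a₀' + δ' < η₁') (hpos' : 0 < η₁')
    (hβm : η₂' + (ρ₂' - η₁' ^ 2) / (η₁' - (a₀' + δ')) < 1)
    {t' : ℝ} (ht' : t' ≤ t) :
    Literature.NumberTheory.LFunctions.NoUnitEigenvalue K t' := by
  refine noUnitEigenvalue_of_quadForm_bounds_of_le hβp hβm (fun f hf => ?_) (fun f hf => ?_) ht'
  · exact quadForm_le_of_temple_galerkin_certificate hK hφm hφb horth M u hu ha₀ hδ hM hD hη₁ hη₂ hρ₂ ha hpos hf
  · have hnK : Continuous fun x => -K x := hK.neg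
    have h := quadForm_le_of_temple_galerkin_certificate hnK hφm' hφb' horth' M' v hv ha₀' hδ' hM' hD'
      hη₁' hη₂' hρ₂' ha' hpos' hf
    -- ∫ f (−𝖪) f = −∫ f 𝖪f
    have hneg : ∫ x in Ioo (-t) t, f x * ∫ y in Ioo (-t) t, -K (x + y) * f y =
        -∫ x in Ioo (-t) t, f x * ∫ y in Ioo (-t) t, K (x + y) * f y := by
      rw [← integral_neg]
      refine integral_congr_ae (Filter.Eventually.of_forall fun x => ?_)
      simp only
      rw [← mul_neg, ← integral_neg]
      congr 1
      refine integral_congr_ae (Filter.Eventually.of_forall fun y => ?_)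
      simp only; ring
    rw [hneg] at h
    linarith

/-- **Instance for Suzuki's single operator** (RH-free): two Temple–Galerkin certificates for `K_θ = limKernel θ`
(`θ > 1`) at window `t` exclude the eigenvalues `±1` of `𝖪_θ[t′]` for every `t′ ≤ t` — the logic of an rh-dbr ET1e
leg certified by the Temple route; such instances are unconditional finite facts, never evidence for RH.
[cite: Suzuki2020IntegralOperators, Thm. 1.2 (K-v)] -/
theorem noUnitEigenvalue_limKernel_of_temple_certificates_of_le {θ t : ℝ} (hθ : 1 < θ)
    {n : ℕ} {φ : Fin n → ℝ → ℝ} (hφm : ∀ i, Measurable (φ i)) {B : ℝ} (hφb : ∀ i x, |φ i x| ≤ B)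
    (horth : ∀ i j, ∫ x in Ioo (-t) t, φ i x * φ j x = if i = j then 1 else 0)
    (M : Matrix (Fin n) (Fin n) ℝ) (u : Fin n → ℝ) (hu : ∑ i, u i ^ 2 = 1)
    {a₀ δ η₁ η₂ ρ₂ : ℝ} (ha₀ : 0 ≤ a₀) (hδ : 0 < δ)
    (hM : ∀ c : Fin n → ℝ, ∑ i, u i * c i = 0 → ∑ i, ∑ j, c i * M i j * c j ≤ a₀ * ∑ i, c i ^ 2)
    (hD : ∫ x in Ioo (-t) t, ∫ y in Ioo (-t) t,
      (Literature.NumberTheory.LFunctions.limKernel θ (x + y) - ∑ i, ∑ j, M i j * φ i x * φ j y) ^ 2 ≤ δ ^ 2)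
    (hη₁ : η₁ ≤ ∫ x in Ioo (-t) t, (∑ i, u i * φ i x) *
      ∫ y in Ioo (-t) t, Literature.NumberTheory.LFunctions.limKernel θ (x + y) * ∑ i, u i * φ i y)
    (hη₂ : ∫ x in Ioo (-t) t, (∑ i, u i * φ i x) *
      ∫ y in Ioo (-t) t, Literature.NumberTheory.LFunctions.limKernel θ (x + y) * ∑ i, u i * φ i y ≤ η₂)
    (hρ₂ : ∫ x in Ioo (-t) t,
      (∫ y in Ioo (-t) t, Literature.NumberTheory.LFunctions.limKernel θ (x + y) * ∑ i, u i * φ i y) ^ 2 ≤ ρ₂)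
    (ha : a₀ + δ < η₁) (hpos : 0 < η₁)
    (hβp : η₂ + (ρ₂ - η₁ ^ 2) / (η₁ - (a₀ + δ)) < 1)
    {n' : ℕ} {φ' : Fin n' → ℝ → ℝ} (hφm' : ∀ i, Measurable (φ' i)) {B' : ℝ} (hφb' : ∀ i x, |φ' i x| ≤ B')
    (horth' : ∀ i j, ∫ x in Ioo (-t) t, φ' i x * φ' j x = if i = j then 1 else 0)
    (M' : Matrix (Fin n') (Fin n') ℝ) (v : Fin n' → ℝ) (hv : ∑ i, v i ^ 2 = 1)
    {a₀' δ' η₁' η₂' ρ₂' : ℝ} (ha₀' : 0 ≤ a₀') (hδ' : 0 < δ')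
    (hM' : ∀ c : Fin n' → ℝ, ∑ i, v i * c i = 0 → ∑ i, ∑ j, c i * M' i j * c j ≤ a₀' * ∑ i, c i ^ 2)
    (hD' : ∫ x in Ioo (-t) t, ∫ y in Ioo (-t) t,
      (-Literature.NumberTheory.LFunctions.limKernel θ (x + y) - ∑ i, ∑ j, M' i j * φ' i x * φ' j y) ^ 2 ≤ δ' ^ 2)
    (hη₁' : η₁' ≤ ∫ x in Ioo (-t) t, (∑ i, v i * φ' i x) *
      ∫ y in Ioo (-t) t, -Literature.NumberTheory.LFunctions.limKernel θ (x + y) * ∑ i, v i * φ' i y)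
    (hη₂' : ∫ x in Ioo (-t) t, (∑ i, v i * φ' i x) *
      ∫ y in Ioo (-t) t, -Literature.NumberTheory.LFunctions.limKernel θ (x + y) * ∑ i, v i * φ' i y ≤ η₂')
    (hρ₂' : ∫ x in Ioo (-t) t,
      (∫ y in Ioo (-t) t, -Literature.NumberTheory.LFunctions.limKernel θ (x + y) * ∑ i, v i * φ' i y) ^ 2 ≤ ρ₂')
    (ha' : a₀' + δ' < η₁') (hpos' : 0 < η₁')
    (hβm : η₂' + (ρ₂' - η₁' ^ 2) / (η₁' - (a₀' + δ')) < 1)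
    {t' : ℝ} (ht' : t' ≤ t) :
    Literature.NumberTheory.LFunctions.NoUnitEigenvalue (Literature.NumberTheory.LFunctions.limKernel θ) t' :=
  noUnitEigenvalue_of_temple_certificates_of_le (Literature.NumberTheory.LFunctions.Suzuki2020_thm12_continuous hθ)
    hφm hφb horth M u hu ha₀ hδ hM hD hη₁ hη₂ hρ₂ ha hpos hβp hφm' hφb' horth' M' v hv ha₀' hδ' hM' hD' hη₁' hη₂' hρ₂'
    ha' hpos' hβm ht'

end Summit.RiemannHypothesis.RiemannHypothesis.Theorems.SuzukiWindowsDoorTempleGalerkin
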